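import Literature.AlgebraicGeometry.ShimuraVarieties.UnitaryShimuraComplexFibreGalois
import Literature.AlgebraicGeometry.ShimuraVarieties.UnitaryBallAutomorphicForms
import HarnessLib

/-!
# The holomorphic dehomogenisation chart of the negative cone through a frame

Topic `Literature/AlgebraicGeometry/ShimuraVarieties`, namespace
`Literature.AlgebraicGeometry.ShimuraVarieties.UnitaryCanonicalModel`.  ONE definition + theorems (no named fact,
no instance, no `sorry`).  Cell `hodgecm-mathlib` (D-0151), T3 (24835 v4.1 market, B-plan2 g5 2026-08-28 word (4),
leaf L1): the chart consumed by the `∀γ` period chart `PeriodChartNegCone` (B-p05) / the β-leaf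
`hasHolomorphicSiegelLift_siegelPointMap` (A-p08).

For a hermitian matrix `H^τ ∈ M₃(ℂ)` of signature `(2,1)` with a Sylvester frame `T` (`Tᴴ · H^τ · T = J`,
`J = diag(1,1,-1)`, the tree's `formCongr (starRingEnd ℂ) T (H.map τ) = BallModel.J`), the negative cone
`{v | ⟪v,v⟫_{H^τ} < 0}` is carried by `T⁻¹` onto the negative cone of `J`, on which the dehomogenisation
`w ↦ (w₀/w₂, w₁/w₂)` is a holomorphic map onto the unit ball `𝔹² ⊂ ℂ²`; the composite
`negConeBallCoord T : v ↦ ((T⁻¹v)₀/(T⁻¹v)₂, (T⁻¹v)₁/(T⁻¹v)₂)` inverts the frame lift `x ↦ T · (x, 1)` of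
★ `frame_mulVec_lift_mem_negCone`.  This is the passage «bounded symmetric domain `𝔹²` ↔ negative lines of
`(V_τ, H^τ)`» of [Milne2005ShimuraVarieties] Def. 12.5 (the hermitian symmetric domain attached to a unitary
Shimura datum), written in coordinates.

* `negConeBallCoord T v` (def) — the chart.
* `negConeBallCoord_frame_lift` — `negConeBallCoord T (T · lift x) = x`.
* `Q_toLin_inv_mulVec_eq` — `Q (T⁻¹ v) = Re ⟪v, v⟫_{H^τ}`; `Q_inv_mulVec_neg_of_mem_negCone`;
  `apply_two_ne_zero_of_mem_negCone` — `(T⁻¹ v)₂ ≠ 0` on the negative cone;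
  `negConeBallCoord_eq_proj` — the chart is `BallModel.proj (T⁻¹ v)`; `negConeBallCoord_mem_ballSet`.
* `differentiableOn_negConeBallCoord`, **`differentiableOn_comp_negConeBallCoord`** — holomorphy of the chart on the
  negative cone and of `P ∘ chart` for `P` holomorphic on the ball.

HC_CM is proved only modulo the 7 printed citations until rung 0 closes; banked leaf (no floor change).

## References
* [Milne2005ShimuraVarieties] J. S. Milne, *Introduction to Shimura varieties* (2005), Def. 12.5 p. 113.
-/

noncomputable section

open Matrix
open Literature.Geometry.ComplexHyperbolic Literature.Geometry.ComplexHyperbolic.BallModel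
open Literature.NumberTheory.Automorphic Literature.NumberTheory.Automorphic.UnitaryGroup

namespace Literature.AlgebraicGeometry.ShimuraVarieties.UnitaryCanonicalModel

variable {L : Type} [Field L] {H : Matrix (Fin 3) (Fin 3) L} {τ : L →+* ℂ} {T : GL (Fin 3) ℂ}

/-- **The dehomogenisation chart of the negative cone through the frame `T`**:
`v ↦ ((T⁻¹v)₀/(T⁻¹v)₂, (T⁻¹v)₁/(T⁻¹v)₂)`. [cite: Milne2005ShimuraVarieties, Def. 12.5 p. 113] -/
def negConeBallCoord (T : GL (Fin 3) ℂ) (v : Fin 3 → ℂ) : Fin 2 → ℂ :=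
  fun i => ((↑T⁻¹ : Matrix (Fin 3) (Fin 3) ℂ) *ᵥ v) (Fin.castSucc i) /
    ((↑T⁻¹ : Matrix (Fin 3) (Fin 3) ℂ) *ᵥ v) 2

/-- `T⁻¹ (T w) = w`. [folklore] -/
private theorem inv_mulVec_mulVec (T : GL (Fin 3) ℂ) (w : Fin 3 → ℂ) :
    (↑T⁻¹ : Matrix (Fin 3) (Fin 3) ℂ) *ᵥ ((T : Matrix (Fin 3) (Fin 3) ℂ) *ᵥ w) = w := by
  rw [mulVec_mulVec, ← Units.val_mul, inv_mul_cancel, Units.val_one, one_mulVec]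

/-- `T (T⁻¹ v) = v`. [folklore] -/
private theorem mulVec_inv_mulVec (T : GL (Fin 3) ℂ) (v : Fin 3 → ℂ) :
    (T : Matrix (Fin 3) (Fin 3) ℂ) *ᵥ ((↑T⁻¹ : Matrix (Fin 3) (Fin 3) ℂ) *ᵥ v) = v := by
  rw [mulVec_mulVec, ← Units.val_mul, mul_inv_cancel, Units.val_one, one_mulVec]

/-- The chart inverts the frame lift: `negConeBallCoord T (T · (x, 1)) = x`.
[cite: Milne2005ShimuraVarieties, Def. 12.5 p. 113] -/
theorem negConeBallCoord_frame_lift (T : GL (Fin 3) ℂ) (x : Ball) :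
    negConeBallCoord T ((T : Matrix (Fin 3) (Fin 3) ℂ) *ᵥ BallModel.lift x) = x.1 := by
  funext i
  simp only [negConeBallCoord, inv_mulVec_mulVec, BallModel.lift_2, div_one]
  fin_cases i <;> rfl

/-- In the frame, `Q (T⁻¹ v) = Re ⟪v, v⟫_{H^τ}` (indeed `⟪v, v⟫ = Q(T⁻¹v)` as complex numbers, `Tᴴ H^τ T = J`).
[cite: Milne2005ShimuraVarieties, Def. 12.5 p. 113] -/
theorem Q_inv_mulVec_eq (hT : formCongr (starRingEnd ℂ) T (H.map τ) = BallModel.J) (v : Fin 3 → ℂ) :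
    ((Q ((↑T⁻¹ : Matrix (Fin 3) (Fin 3) ℂ) *ᵥ v) : ℝ) : ℂ) = hermForm (starRingEnd ℂ) (H.map τ) v v := by
  have hJ : BallModel.J = (T : Matrix (Fin 3) (Fin 3) ℂ)ᴴ * H.map τ * (T : Matrix (Fin 3) (Fin 3) ℂ) := by
    rw [← hT, formCongr_star]
  rw [hermForm_starRingEnd, ← form_eq_Q, hJ, ← mulVec_mulVec, ← mulVec_mulVec, mulVec_inv_mulVec,
    dotProduct_mulVec, ← star_mulVec, mulVec_inv_mulVec]

/-- On the negative cone of `H^τ`, `T⁻¹ v` is `J`-negative. [cite: Milne2005ShimuraVarieties, Def. 12.5 p. 113] -/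
theorem Q_inv_mulVec_neg_of_mem_negCone (hT : formCongr (starRingEnd ℂ) T (H.map τ) = BallModel.J)
    {v : Fin 3 → ℂ} (hv : v ∈ negCone (H.map τ)) :
    Q ((↑T⁻¹ : Matrix (Fin 3) (Fin 3) ℂ) *ᵥ v) < 0 := by
  have h := congrArg Complex.re (Q_inv_mulVec_eq hT v)
  rw [Complex.ofReal_re] at h
  rw [h]
  exact hv

/-- On the negative cone the last frame coordinate does not vanish: `(T⁻¹ v)₂ ≠ 0`.
[cite: Milne2005ShimuraVarieties, Def. 12.5 p. 113] -/
theorem apply_two_ne_zero_of_mem_negCone (hT : formCongr (starRingEnd ℂ) T (H.map τ) = BallModel.J)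
    {v : Fin 3 → ℂ} (hv : v ∈ negCone (H.map τ)) :
    ((↑T⁻¹ : Matrix (Fin 3) (Fin 3) ℂ) *ᵥ v) 2 ≠ 0 :=
  BallModel.ne_zero_of_Q_neg (Q_inv_mulVec_neg_of_mem_negCone hT hv)

/-- The chart is the tree's projection `BallModel.proj` of the frame coordinates.
[cite: Milne2005ShimuraVarieties, Def. 12.5 p. 113] -/
theorem negConeBallCoord_eq_proj (hT : formCongr (starRingEnd ℂ) T (H.map τ) = BallModel.J)
    {v : Fin 3 → ℂ} (hv : v ∈ negCone (H.map τ)) :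
    negConeBallCoord T v = (BallModel.proj _ (Q_inv_mulVec_neg_of_mem_negCone hT hv)).1 := by
  funext i
  rw [BallModel.proj_val]
  rfl

/-- The chart lands in the unit ball `𝔹² ⊂ ℂ²`. [cite: Milne2005ShimuraVarieties, Def. 12.5 p. 113] -/
theorem negConeBallCoord_mem_ballSet (hT : formCongr (starRingEnd ℂ) T (H.map τ) = BallModel.J)
    {v : Fin 3 → ℂ} (hv : v ∈ negCone (H.map τ)) :
    negConeBallCoord T v ∈ BallForms.ballSet := by
  rw [negConeBallCoord_eq_proj hT hv]
  exact (BallModel.proj _ (Q_inv_mulVec_neg_of_mem_negCone hT hv)).2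

/-- The frame coordinates `v ↦ (T⁻¹ v)ₖ` are holomorphic (linear). [folklore] -/
private theorem differentiable_inv_mulVec_apply (T : GL (Fin 3) ℂ) (k : Fin 3) :
    Differentiable ℂ (fun v : Fin 3 → ℂ => ((↑T⁻¹ : Matrix (Fin 3) (Fin 3) ℂ) *ᵥ v) k) := by
  have hlin : Differentiable ℂ (fun v : Fin 3 → ℂ => (↑T⁻¹ : Matrix (Fin 3) (Fin 3) ℂ) *ᵥ v) := by
    have h := (LinearMap.toContinuousLinearMap
      (Matrix.mulVecLin (↑T⁻¹ : Matrix (Fin 3) (Fin 3) ℂ))).differentiable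
    convert h using 1
    funext v
    simp only [LinearMap.coe_toContinuousLinearMap', Matrix.mulVecLin_apply]
  exact differentiable_pi.1 hlin k

/-- **The chart is holomorphic on the negative cone.** [cite: Milne2005ShimuraVarieties, Def. 12.5 p. 113] -/
theorem differentiableOn_negConeBallCoord (hT : formCongr (starRingEnd ℂ) T (H.map τ) = BallModel.J) :
    DifferentiableOn ℂ (negConeBallCoord T) (negCone (H.map τ)) := by
  refine differentiableOn_pi.2 fun i => ?_
  have h1 : DifferentiableOn ℂ (fun v : Fin 3 → ℂ => ((↑T⁻¹ : Matrix (Fin 3) (Fin 3) ℂ) *ᵥ v) (Fin.castSucc i))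
      (negCone (H.map τ)) := (differentiable_inv_mulVec_apply T _).differentiableOn
  have h2 : DifferentiableOn ℂ (fun v : Fin 3 → ℂ => ((↑T⁻¹ : Matrix (Fin 3) (Fin 3) ℂ) *ᵥ v) 2)
      (negCone (H.map τ)) := (differentiable_inv_mulVec_apply T 2).differentiableOn
  have heq : (fun v => negConeBallCoord T v i) = fun v =>
      ((↑T⁻¹ : Matrix (Fin 3) (Fin 3) ℂ) *ᵥ v) (Fin.castSucc i) * (((↑T⁻¹ : Matrix (Fin 3) (Fin 3) ℂ) *ᵥ v) 2)⁻¹ := by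
    funext v
    simp only [negConeBallCoord, div_eq_mul_inv]
  rw [heq]
  exact h1.mul (h2.inv fun v hv => apply_two_ne_zero_of_mem_negCone hT hv)

/-- **Holomorphic functions on the ball pull back to holomorphic functions on the negative cone** along the
chart: for `P` holomorphic on `𝔹²`, `v ↦ P (negConeBallCoord T v)` is holomorphic on the negative cone of
`H^τ`. [cite: Milne2005ShimuraVarieties, Def. 12.5 p. 113] -/
theorem differentiableOn_comp_negConeBallCoord {E : Type*} [NormedAddCommGroup E] [NormedSpace ℂ E]
    (hT : formCongr (starRingEnd ℂ) T (H.map τ) = BallModel.J) {P : (Fin 2 → ℂ) → E}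
    (hP : DifferentiableOn ℂ P BallForms.ballSet) :
    DifferentiableOn ℂ (fun v => P (negConeBallCoord T v)) (negCone (H.map τ)) :=
  hP.comp (differentiableOn_negConeBallCoord hT) fun _ hv => negConeBallCoord_mem_ballSet hT hv

end Literature.AlgebraicGeometry.ShimuraVarieties.UnitaryCanonicalModel
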